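import Summits.QuantumFields.YangMills.Theorems.GronwallGapContinuumFromLatticeGapDockUniform
import Summits.QuantumFields.YangMills.Theorems.GronwallGapContinuumFromLatticeGapStubLawToCofinal
import HarnessLib

/-!
# `ContinuumFromLatticeGap` (stmt-QuantumFields-15915), line `registered`, reshape 7: the def-free compositions over the
# POINTWISE ONE-SCALE LAW

Support file for the crux item stmt-QuantumFields-15915 (`GronwallGap.ContinuumFromLatticeGap`), reshape 7 of line
`registered`.  Reshape 6 (p168721) closed this crux and the sibling stmt-QuantumFields-15828 from `XiDiverges`, the
datum-relative ONE-SCALE stub with cofinal volumes, U_R, W₂ᴳ and orientation amnesia BY NAME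
(`continuumFromLatticeGap_of_uniform`, `continuumLegGivenGap_of_uniform`).  Reshape 7 replaces the datum-relative stub by
the POINTWISE ONE-SCALE LAW (registered open stub `stub_oneScaleLaw` of `Cruxes/ContinuumFromLatticeGap/Lines/birth.lean`):
for every sharpness `K > 0` ONE bump, `p`, `M`, `Δ₀`, `β₀`, `m₀` such that at every coupling `β ≥ β₀` and every `K`-sharp
uniform clustering rate `0 < m ≤ m₀` some unit `a` with `Δ₀ a ≤ m` carries the floor and the one-step window of the bare
truncated curvature two-point function on a cofinal set of tori.  The landed bridge `stub_lawToCofinal` (p172854) turns the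
law into the reshape-6 stub verbatim, so both cruxes are closed from `XiDiverges`, the LAW, U_R, W₂ᴳ and amnesia BY NAME —
the two theorems of this file.  Refs: GlimmJaffe1987 §6.1, §19.1; OsterwalderSeiler1978 §§2–3.
-/

noncomputable section

namespace Summit.QuantumFields.YangMills.Theorems.ContinuumFromLatticeGap

open scoped SchwartzMap
open Filter Topology MeasureTheory
open Literature.MathematicalPhysics.QuantumFieldTheory Literature.MathematicalPhysics.QuantumLattice
  Literature.Probability.LatticeModels
open Summit.QuantumFields.YangMills.Theses

/-- **`continuumFromLatticeGap_of_law`** — the crux `GronwallGap.ContinuumFromLatticeGap` from `XiDiverges` (stmt-8941), the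
POINTWISE ONE-SCALE LAW (registered open stub `stub_oneScaleLaw` of line `registered`, reshape 7), U_R (stmt-18014), W₂ᴳ
(stmt-18170) and orientation amnesia (stmt-16192) BY NAME: the landed bridge `stub_lawToCofinal` feeds the reshape-6
composition `continuumFromLatticeGap_of_uniform`. [cite: GlimmJaffe1987, §6.1 and §19.1] -/
theorem continuumFromLatticeGap_of_law (hXi : DirichletWindow.XiDiverges)
    (hLaw : ∀ (G : Type) [Group G] [TopologicalSpace G] [IsTopologicalGroup G] [CompactSpace G]
      [MeasurableSpace G] [BorelSpace G], IsCompactSimpleLieGroup G → ∃ r : LatticeRep G, ∀ K : ℝ, 0 < K →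
      ∃ (u : 𝓢(EuclideanSpace ℝ (Fin 4), ℝ)) (p : ℕ) (M Δ₀ β₀ m₀ : ℝ),
        tsupport u ⊆ {y : EuclideanSpace ℝ (Fin 4) | y 0 < 0} ∧ 0 < Δ₀ ∧ 0 < m₀ ∧
        ∀ (β m : ℝ) (T₀ : ℕ), β₀ ≤ β → 0 < m → m ≤ m₀ →
          (∀ A B : YMSpecies G, ∃ C : ℝ, ∀ S n : ℕ, T₀ ≤ S → n ≤ S →
            |latticeConnectedCorr r.ρ β (2 * S + 1) A.F B.F n| ≤ C * Real.exp (-(m * n))) →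
          (∀ S₀ : ℕ, ∃ A B : YMSpecies G, ∀ C : ℝ, ∃ S n : ℕ, S₀ ≤ S ∧ n ≤ S ∧
            C * Real.exp (-(K * m * n)) < |latticeConnectedCorr r.ρ β (2 * S + 1) A.F B.F n|) →
          ∃ a : ℝ, 0 < a ∧ Δ₀ * a ≤ m ∧ ∀ L₁ : ℕ, ∃ L : ℕ, L₁ ≤ L ∧
            ∀ T : 𝓢(EuclideanSpace ℝ (Fin 4), ℝ) → ℝ,
              (∀ w, T w =
                (∫ U, smearedLatticeField r.curvature.F (box 4 L) a 1 0 w (torusLift (2 * L + 1) U) *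
                    smearedLatticeField r.curvature.F (box 4 L) a 1 0 (thetaTest 4 w) (torusLift (2 * L + 1) U)
                  ∂(wilsonMeasure r.ρ β : Measure (GaugeConfig 4 (2 * L + 1) G))) -
                (∫ U, smearedLatticeField r.curvature.F (box 4 L) a 1 0 w (torusLift (2 * L + 1) U)
                  ∂(wilsonMeasure r.ρ β : Measure (GaugeConfig 4 (2 * L + 1) G))) *
                (∫ U, smearedLatticeField r.curvature.F (box 4 L) a 1 0 (thetaTest 4 w) (torusLift (2 * L + 1) U)
                  ∂(wilsonMeasure r.ρ β : Measure (GaugeConfig 4 (2 * L + 1) G)))) →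
              a ^ p ≤ T u ∧ T u ≤ M * T (timeShiftTest 4 (-1) u))
    (hU : ScalingWindowSplit.SelfNormalisedMomentBoundsR) (hW₂ : ScalingWindowSplit.SelfNormalisedSkewnessGapped)
    (hA : CoincidenceRotationBootstrap.CurvatureAmnesia) :
    GronwallGap.ContinuumFromLatticeGap :=
  continuumFromLatticeGap_of_uniform hXi (stub_lawToCofinal hLaw) hU hW₂ hA

/-- **`continuumLegGivenGap_of_law`** — the sibling crux stmt-QuantumFields-15828 `ComplexCouplingChannel.ContinuumLegGivenGap`
from `XiDiverges`, the POINTWISE ONE-SCALE LAW, U_R, W₂ᴳ and orientation amnesia BY NAME (bridge + reshape-6 composition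
`continuumLegGivenGap_of_uniform`). [cite: GlimmJaffe1987, §6.1 and §19.1] -/
theorem continuumLegGivenGap_of_law (hXi : DirichletWindow.XiDiverges)
    (hLaw : ∀ (G : Type) [Group G] [TopologicalSpace G] [IsTopologicalGroup G] [CompactSpace G]
      [MeasurableSpace G] [BorelSpace G], IsCompactSimpleLieGroup G → ∃ r : LatticeRep G, ∀ K : ℝ, 0 < K →
      ∃ (u : 𝓢(EuclideanSpace ℝ (Fin 4), ℝ)) (p : ℕ) (M Δ₀ β₀ m₀ : ℝ),
        tsupport u ⊆ {y : EuclideanSpace ℝ (Fin 4) | y 0 < 0} ∧ 0 < Δ₀ ∧ 0 < m₀ ∧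
        ∀ (β m : ℝ) (T₀ : ℕ), β₀ ≤ β → 0 < m → m ≤ m₀ →
          (∀ A B : YMSpecies G, ∃ C : ℝ, ∀ S n : ℕ, T₀ ≤ S → n ≤ S →
            |latticeConnectedCorr r.ρ β (2 * S + 1) A.F B.F n| ≤ C * Real.exp (-(m * n))) →
          (∀ S₀ : ℕ, ∃ A B : YMSpecies G, ∀ C : ℝ, ∃ S n : ℕ, S₀ ≤ S ∧ n ≤ S ∧
            C * Real.exp (-(K * m * n)) < |latticeConnectedCorr r.ρ β (2 * S + 1) A.F B.F n|) →
          ∃ a : ℝ, 0 < a ∧ Δ₀ * a ≤ m ∧ ∀ L₁ : ℕ, ∃ L : ℕ, L₁ ≤ L ∧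
            ∀ T : 𝓢(EuclideanSpace ℝ (Fin 4), ℝ) → ℝ,
              (∀ w, T w =
                (∫ U, smearedLatticeField r.curvature.F (box 4 L) a 1 0 w (torusLift (2 * L + 1) U) *
                    smearedLatticeField r.curvature.F (box 4 L) a 1 0 (thetaTest 4 w) (torusLift (2 * L + 1) U)
                  ∂(wilsonMeasure r.ρ β : Measure (GaugeConfig 4 (2 * L + 1) G))) -
                (∫ U, smearedLatticeField r.curvature.F (box 4 L) a 1 0 w (torusLift (2 * L + 1) U)
                  ∂(wilsonMeasure r.ρ β : Measure (GaugeConfig 4 (2 * L + 1) G))) *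
                (∫ U, smearedLatticeField r.curvature.F (box 4 L) a 1 0 (thetaTest 4 w) (torusLift (2 * L + 1) U)
                  ∂(wilsonMeasure r.ρ β : Measure (GaugeConfig 4 (2 * L + 1) G)))) →
              a ^ p ≤ T u ∧ T u ≤ M * T (timeShiftTest 4 (-1) u))
    (hU : ScalingWindowSplit.SelfNormalisedMomentBoundsR) (hW₂ : ScalingWindowSplit.SelfNormalisedSkewnessGapped)
    (hA : CoincidenceRotationBootstrap.CurvatureAmnesia) :
    ComplexCouplingChannel.ContinuumLegGivenGap :=
  continuumLegGivenGap_of_uniform hXi (stub_lawToCofinal hLaw) hU hW₂ hA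

end Summit.QuantumFields.YangMills.Theorems.ContinuumFromLatticeGap

end
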